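import Mathlib
import Summits.Langlands.Langlands.Theses.HeckeFieldDeRham
import Literature.NumberTheory.Automorphic.AutomorphicRepsGLSatakeFlathProofs
import Literature.NumberTheory.Automorphic.SatakeParamNeZeroProofs
import Literature.NumberTheory.Automorphic.LanglandsTetrahedralProofs
import Literature.NumberTheory.Automorphic.AdelicSecondCountable
import Summits.Langlands.Langlands.Theorems.IrreducibilityBySelfDualityHeckeEigenvalueFieldStubS3
import Summits.Langlands.Langlands.Theorems.IrreducibilityBySelfDualityHeckeEigenvalueFieldBaireUnif

/-!
# Crux `LArithmeticity` (stmt-Langlands-17409, route HeckeFieldDeRham) — line `conjugates-baire`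
(strategist planner-cstrat-stmt-Langlands-17409-b1-0, 2026-08-17)

Buzzard–Gee Conj. 3.1.5 ("L-algebraic ⟹ L-arithmetic", cuspidal `GL_n`, read through `ι`) from
TWO registered stubs and a kernel-checked composition:

* `stub_S4L` — COUNTABILITY OF GERMS (theorem-sized, provable now): for fixed `n, K` the
  L-normalised unramified eigensystems `(v, i) ↦ e_i(α_v)` of the L-ALGEBRAIC cuspidal `π` on
  `GL_n(𝔸_K)` agree, off finite sets, with members of ONE countable set.  The landed (S4) of line
  `BaireSketch` of crux `HeckeEigenvalueField` (`countable_heckeEigensystems`,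
  `…HeckeEigenvalueFieldS4.lean`) is this statement for REGULAR algebraic `π` and Tamagawa-normalised
  eigenvalues `t_{v,i} = q_v^{i(n-i)/2} e_i(α)`; its proof uses `IsRegularAlgebraic` ONLY through
  `stub_B1` (the infinity type pins the `Z(𝔤)`-character from a countable set), and `stub_B1` only
  uses integrality of the weights modulo `(n-1)/2` — for L-algebraic `π` the weights are in `ℤ`
  (`InfinityType.IsLAlgebraic`), so the same assembly (stubs A, B2, C1–C3, Harish-Chandra
  finiteness, all landed) proves `stub_S4L` after replacing `(e σ k : ℂ) + (n-1)/2` by `(e σ k : ℂ)`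
  in `stub_B1` and dividing by `q_v^{i(n-i)/2} ≠ 0`.
* `stub_autConjL` — `Aut(ℂ)`-STABILITY OF THE L-ALGEBRAIC CUSPIDAL SPECTRUM ON L-NORMALISED SATAKE
  DATA (the hard stub; open for irregular `π`): for every L-algebraic cuspidal `π` and every
  `σ ∈ Aut(ℂ/ℚ)` there is an L-algebraic cuspidal `π'` with `e_i(α'_v) = σ(e_i(α_v))` at almost all
  `v`.  Known sectors: regular (Clozel 1990 Thm. 3.13 (ii), tree fact `Clozel1990_exists_autConjugate`
  up to the C/L half-twist), holomorphic limits of discrete series / NDLDS realised in coherent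
  cohomology (Blasius–Harris–Ramakrishnan, Duke 73 (1994)), `n = 1` (Weil).  For `n` even this is
  NOT `IsAutConjugate` (which conjugates `t_{v,i}`, the C-normalisation): the two differ by the sign
  cocycle `σ(√q_v)/√q_v`, which is not a Hecke character.
* `lArithmeticity_of_countableGerms_autConj` (PROVED, hypotheses = the two stub statements) and
  `LArithmeticity_of : LArithmeticity` (the crux BY NAME from the declared stubs): Satake uniqueness turns `stub_autConjL` into "σ ∘ germ(π) is a.e.
  the germ of π'", `stub_S4L` makes the `Aut(ℂ)`-orbit of the germ countable, the landed `stub_S3` +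
  Baire uniformisation `uniform_of_countable_autOrbit` give ONE number field `E₀ ⊂ ℂ` containing
  `e_i(α_v)` for a.e. `v`; the coefficients of `∏ (X - a⁻¹)` are `± e_{n-k}(α)/e_n(α)`
  (`esymm_map_inv_mul_prod`, `e_n(α) ≠ 0` by `hasSatakeParamAt_ne_zero_holds`), and
  `arithFrobPolyOfSatake ι q_v 1 α` is that polynomial mapped along `ι⁻¹`, so its coefficients lie in
  the number field `E := ι⁻¹(E₀) ⊂ ℚ̄_ℓ` (`Subfield.comap ι`).

Sorries ONLY inside `stub_*`.
-/

set_option linter.dupNamespace false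

noncomputable section

namespace Summit.Langlands.Langlands.Cruxes.LArithmeticity.ConjugatesBaire

open scoped Classical Polynomial
open Filter NumberField IsDedekindDomain Polynomial
open Literature.NumberTheory.Automorphic
open Summit.Langlands.Langlands.Theorems.HeckeEigenvalueField.Baire

/-! ## The stubs -/

/-- **stub_S4L — countability of the L-normalised unramified eigensystem germs of L-algebraic
cuspidal representations** (statement (S4) of line `BaireSketch`/crux `HeckeEigenvalueField` with
`IsLAlgebraic` for `IsRegularAlgebraic` and `e_i(α)` for `t_{v,i} = q_v^{i(n-i)/2} e_i(α)`): for fixed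
`n, K` there is a countable set `𝒞` of functions on (finite places × `{0,…,n}`) such that for every
L-algebraic cuspidal `π` on `GL_n(𝔸_K)` some `c ∈ 𝒞` satisfies `e_i(α) = c (v, i)` for every Satake
parameter `α` of `π` at `v` and every `i ≤ n`, for all but finitely many `v`.  Provable now: copy
`countable_heckeEigensystems` (`…HeckeEigenvalueFieldS4.lean`) with `stub_B`/`stub_B1` re-run for
L-algebraic `π` (integral weights, countably many `Z(𝔤)`-characters; Harish-Chandra finiteness
`harishChandra_finiteness_holds`), then divide by `q_v^{i(n-i)/2} ≠ 0`. Size: L (mechanical).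
[cite: HarishChandra1968, Thm. 1] [cite: BorelJacquet1979, §4.3–4.6] [cite: Clozel1990, §3.3–3.5] -/
theorem stub_S4L : ∀ (n : ℕ) (K : Type) [Field K] [NumberField K]
    (hcpt : isCompact_glFiniteIntegralLevel n K),
    ∃ 𝒞 : Set (HeightOneSpectrum (𝓞 K) × Fin (n + 1) → ℂ), 𝒞.Countable ∧
      ∀ π : CuspidalAutomorphicRepData n K hcpt, π.1.IsLAlgebraic →
        ∃ c ∈ 𝒞, ∀ᶠ v : HeightOneSpectrum (𝓞 K) in cofinite, ∀ α : Multiset ℂ,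
          π.1.HasSatakeParamAt v α → ∀ i : Fin (n + 1), α.esymm i = c (v, i) := by
  sorry

/-- **stub_autConjL — `Aut(ℂ)`-conjugates of L-algebraic cuspidal representations exist, on
L-normalised Satake data** (the `GL_n` cuspidal L-normalised form of the `Aut(ℂ)`-stability behind
Buzzard–Gee Conj. 3.1.5/3.1.6 and Clozel 1990 Thm. 3.13 (ii); OPEN for irregular `π`): for every
L-algebraic cuspidal `π` on `GL_n(𝔸_K)` and every `σ ∈ Aut(ℂ/ℚ)` there is an L-algebraic cuspidal
`π'` such that at all but finitely many finite places both are unramified and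
`e_i(α') = σ (e_i(α))` for all `i ≤ n` (equivalently `∏_{a ∈ α'} (X - a) = σ(∏_{a ∈ α} (X - a))`).
Known: regular `π` (Clozel (ii), after the half-twist `|det|^{(n-1)/2}` when `n` is even; tree fact
`Clozel1990_exists_autConjugate`, unproved in tree for `n ≥ 2`), `n ≤ 1`, holomorphic (limit of)
discrete series Hilbert modular forms and NDLDS classes in coherent cohomology of Shimura varieties
(Blasius–Harris–Ramakrishnan 1994).  Why it might fail: an even Maass form of eigenvalue `1/4`
(parameter `1 ⊕ 1` at `∞`) whose `σ`-conjugate eigensystem is not automorphic.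
[cite: Clozel1990, Thm. 3.13 (ii)] [cite: BuzzardGeeLMS2014, Conj. 3.1.5–3.1.6]
[cite: BlasiusHarrisRamakrishnan1994, Duke Math. J. 73, 647–685] -/
theorem stub_autConjL : ∀ (n : ℕ) (K : Type) [Field K] [NumberField K]
    (hcpt : isCompact_glFiniteIntegralLevel n K)
    (π : CuspidalAutomorphicRepData n K hcpt), π.1.IsLAlgebraic → ∀ σ : ℂ ≃ₐ[ℚ] ℂ,
      ∃ π' : CuspidalAutomorphicRepData n K hcpt, π'.1.IsLAlgebraic ∧
        ∀ᶠ v : HeightOneSpectrum (𝓞 K) in cofinite, ∃ α α' : Multiset ℂ,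
          π.1.HasSatakeParamAt v α ∧ π'.1.HasSatakeParamAt v α' ∧
            ∀ i ≤ n, α'.esymm i = σ (α.esymm i) := by
  sorry

/-! ## Helper lemmas of the composition (all proved) -/

/-- The coefficients of the reciprocal polynomial `∏_{a ∈ α} (X - a⁻¹)` lie in any subfield
containing `e_0(α), …, e_n(α)` (`n = card α`), provided `0 ∉ α`:
`coeff_k = (-1)^{n-k} e_{n-k}(α⁻¹) = (-1)^{n-k} e_k(α) / e_n(α)`. [folklore] -/
theorem coeff_prod_X_sub_C_inv_mem {E₀ : Subfield ℂ} {α : Multiset ℂ} (h0 : ∀ a ∈ α, a ≠ 0)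
    (hes : ∀ i ≤ Multiset.card α, α.esymm i ∈ E₀) (k : ℕ) :
    ((α.map fun a => X - C a⁻¹).prod).coeff k ∈ E₀ := by
  have hmap : (α.map fun a => X - C a⁻¹) = ((α.map (·⁻¹)).map fun b => X - C b) := by
    rw [Multiset.map_map]
    rfl
  rw [hmap]
  set β : Multiset ℂ := α.map (·⁻¹) with hβ
  have hcard : Multiset.card β = Multiset.card α := by rw [hβ, Multiset.card_map]
  by_cases hk : k ≤ Multiset.card β
  · rw [Multiset.prod_X_sub_C_coeff β hk]
    refine mul_mem (pow_mem (neg_mem (one_mem E₀)) _) ?_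
    -- `e_{n-k}(α⁻¹) · e_n(α) = e_k(α)`
    have hprod : α.prod ≠ 0 := Multiset.prod_ne_zero fun h => h0 0 h rfl
    have hrel := esymm_map_inv_mul_prod α h0 (j := Multiset.card β - k) (k := k)
      (by rw [hcard]; omega)
    have hen : α.prod = α.esymm (Multiset.card α) := by
      rw [Multiset.esymm, Multiset.powersetCard_self, Multiset.map_singleton, Multiset.sum_singleton]
    have heq : β.esymm (Multiset.card β - k) = α.esymm k / α.prod := by
      rw [eq_div_iff hprod, hβ]
      exact hrel
    rw [heq, hen]
    exact div_mem (hes k (hcard ▸ hk)) (hes _ le_rfl)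
  · rw [Polynomial.coeff_eq_zero_of_natDegree_lt]
    · exact zero_mem E₀
    · rw [Polynomial.natDegree_multiset_prod_X_sub_C_eq_card]
      omega

variable {ℓ : ℕ} [Fact ℓ.Prime]

/-- `arithFrobPolyOfSatake ι q 1 α` is `ι⁻¹` applied coefficientwise to `∏_{a ∈ α} (X - a⁻¹)`. [folklore] -/
theorem arithFrobPolyOfSatake_one_eq_map (ι : PadicAlgCl ℓ ≃+* ℂ) (q : ℕ) (α : Multiset ℂ) :
    arithFrobPolyOfSatake ι q 1 α =
      ((α.map fun a => X - C a⁻¹).prod).map (ι.symm : ℂ →+* PadicAlgCl ℓ) := by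
  rw [arithFrobPolyOfSatake_one, Polynomial.map_multiset_prod, Multiset.map_map]
  congr 1
  refine Multiset.map_congr rfl fun a _ => ?_
  simp

/-- The pull-back `ι⁻¹(E₀) ⊂ ℚ̄_ℓ` of a number field `E₀ ⊂ ℂ` along `ι : ℚ̄_ℓ ≃ ℂ` is finite over `ℚ`
(an additive bijection between `ℚ`-vector spaces is `ℚ`-linear). [folklore] -/
theorem finiteDimensional_comap (ι : PadicAlgCl ℓ ≃+* ℂ) (E₀ : Subfield ℂ)
    [hfd : FiniteDimensional ℚ E₀] :
    FiniteDimensional ℚ (E₀.comap (ι : PadicAlgCl ℓ →+* ℂ)) := by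
  let g : E₀ →+ E₀.comap (ι : PadicAlgCl ℓ →+* ℂ) :=
    { toFun := fun y => ⟨ι.symm y, by
        rw [Subfield.mem_comap]
        simp [y.2]⟩
      map_zero' := by ext; simp
      map_add' := fun x y => by ext; simp }
  have hg : Function.Surjective g := by
    intro x
    have hx : ι (x : PadicAlgCl ℓ) ∈ E₀ := Subfield.mem_comap.1 x.2
    refine ⟨⟨ι x, hx⟩, ?_⟩
    ext
    simp [g]
  exact Module.Finite.of_surjective g.toRatLinearMap hg

/-! ## The composition -/

/-- **The text of `LArithmeticity` from the two stub STATEMENTS** (kernel-checked, no sorry; the by-name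
closure from the declared stubs is `LArithmeticity_of` below): (S4L) + (autConjL) ⟹ the crux.
Satake uniqueness (`hasSatakeParamAt_unique_holds`) makes the L-normalised eigensystem of `π` a
function `a`; `autConjL` + (S4L) put every `σ ∘ a` a.e. inside the countable `𝒞`; `stub_S3` + Baire
(`uniform_of_countable_autOrbit`, landed) give one number field `E₀ ⊂ ℂ` with `e_i(α_v) ∈ E₀` a.e.;
the reciprocal polynomial has coefficients in `E₀` (`coeff_prod_X_sub_C_inv_mem`,
`hasSatakeParamAt_ne_zero_holds`) and `arithFrobPolyOfSatake ι q_v 1 α` is its image under `ι⁻¹`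
(`arithFrobPolyOfSatake_one_eq_map`), whence coefficients in `E := ι⁻¹(E₀)`, a number field
(`finiteDimensional_comap`). [folklore] -/
theorem lArithmeticity_of_countableGerms_autConj :
    (∀ (n : ℕ) (K : Type) [Field K] [NumberField K]
      (hcpt : isCompact_glFiniteIntegralLevel n K),
      ∃ 𝒞 : Set (HeightOneSpectrum (𝓞 K) × Fin (n + 1) → ℂ), 𝒞.Countable ∧
        ∀ π : CuspidalAutomorphicRepData n K hcpt, π.1.IsLAlgebraic →
          ∃ c ∈ 𝒞, ∀ᶠ v : HeightOneSpectrum (𝓞 K) in cofinite, ∀ α : Multiset ℂ,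
            π.1.HasSatakeParamAt v α → ∀ i : Fin (n + 1), α.esymm i = c (v, i)) →
    (∀ (n : ℕ) (K : Type) [Field K] [NumberField K]
      (hcpt : isCompact_glFiniteIntegralLevel n K)
      (π : CuspidalAutomorphicRepData n K hcpt), π.1.IsLAlgebraic → ∀ σ : ℂ ≃ₐ[ℚ] ℂ,
        ∃ π' : CuspidalAutomorphicRepData n K hcpt, π'.1.IsLAlgebraic ∧
          ∀ᶠ v : HeightOneSpectrum (𝓞 K) in cofinite, ∃ α α' : Multiset ℂ,
            π.1.HasSatakeParamAt v α ∧ π'.1.HasSatakeParamAt v α' ∧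
              ∀ i ≤ n, α'.esymm i = σ (α.esymm i)) →
    -- the text of `HeckeFieldDeRham.LArithmeticity`, verbatim (the by-name closure is `LArithmeticity_of`)
    ∀ (n : ℕ) (F : Type) [Field F] [NumberField F]
      (hcpt : Literature.NumberTheory.Automorphic.isCompact_glFiniteIntegralLevel n F)
      (π : Literature.NumberTheory.Automorphic.CuspidalAutomorphicRepData n F hcpt), π.1.IsLAlgebraic →
      ∀ (ℓ : ℕ) [Fact ℓ.Prime] (ι : PadicAlgCl ℓ ≃+* ℂ), ∃ E : Subfield (PadicAlgCl ℓ), FiniteDimensional ℚ E ∧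
        ∀ᶠ v : IsDedekindDomain.HeightOneSpectrum (NumberField.RingOfIntegers F) in Filter.cofinite,
          ∀ α : Multiset ℂ, π.1.HasSatakeParamAt v α →
            ∀ i : ℕ, (Literature.NumberTheory.Automorphic.arithFrobPolyOfSatake ι v.residueCard 1 α).coeff i ∈ E := by
  intro hS4 hA n F _ _ hcpt π hπ ℓ _ ι
  classical
  haveI : Countable (HeightOneSpectrum (𝓞 F)) := countable_heightOneSpectrum F
  obtain ⟨𝒞, h𝒞, h𝒞π⟩ := hS4 n F hcpt
  -- the L-normalised eigensystem of `π` as a genuine function (`0` where ramified)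
  let a : HeightOneSpectrum (𝓞 F) × Fin (n + 1) → ℂ := fun p =>
    if h : π.1.IsUnramifiedAt p.1 then (Classical.choose h).esymm p.2 else 0
  have ha : ∀ {v : HeightOneSpectrum (𝓞 F)} {α : Multiset ℂ} (_ : π.1.HasSatakeParamAt v α)
      (i : Fin (n + 1)), a (v, i) = α.esymm i := by
    intro v α hα i
    have h : π.1.IsUnramifiedAt v := ⟨α, hα⟩
    show (if h : π.1.IsUnramifiedAt v then (Classical.choose h).esymm i else 0) = _
    rw [dif_pos h]
    congr 1
    exact AutomorphicRepData.hasSatakeParamAt_unique_holds π.1 (Classical.choose_spec h) hα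
  -- `autConjL` + Satake uniqueness + (S4L): the `Aut(ℂ)`-orbit of `a` lies in `𝒞` modulo finite sets
  have horbit : ∀ σ : ℂ ≃ₐ[ℚ] ℂ, ∃ c ∈ 𝒞, ∀ᶠ p in cofinite, σ (a p) = c p := by
    intro σ
    obtain ⟨π', hπ', hconj⟩ := hA n F hcpt π hπ σ
    obtain ⟨c, hc, hc'⟩ := h𝒞π π' hπ'
    refine ⟨c, hc, ?_⟩
    have hplaces : ∀ᶠ v : HeightOneSpectrum (𝓞 F) in cofinite, ∀ i : Fin (n + 1),
        σ (a (v, i)) = c (v, i) := by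
      filter_upwards [hconj, hc'] with v hv hcv i
      obtain ⟨α, α', hα, hα', ht⟩ := hv
      rw [ha hα, ← hcv α' hα' i]
      exact (ht i (Nat.lt_succ_iff.1 i.2)).symm
    have hfin := Filter.eventually_cofinite.1 hplaces
    refine Filter.eventually_cofinite.2 ((hfin.prod (Set.finite_univ (α := Fin (n + 1)))).subset ?_)
    rintro ⟨v, i⟩ hp
    refine ⟨?_, Set.mem_univ _⟩
    intro hall
    exact hp (hall i)
  -- (S3) + Baire uniformisation: ONE number field `E₀ ⊂ ℂ`
  obtain ⟨E₀, hE₀, hmem⟩ := uniform_of_countable_autOrbit stub_S3 a 𝒞 h𝒞 horbit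
  haveI := hE₀
  have hbad : {p : HeightOneSpectrum (𝓞 F) × Fin (n + 1) | ¬ a p ∈ E₀}.Finite :=
    Filter.eventually_cofinite.1 hmem
  have hplaces : ∀ᶠ v : HeightOneSpectrum (𝓞 F) in cofinite, ∀ α : Multiset ℂ,
      π.1.HasSatakeParamAt v α → ∀ i ≤ n, α.esymm i ∈ E₀ := by
    refine Filter.eventually_cofinite.2 ((hbad.image Prod.fst).subset fun v hv => ?_)
    by_contra hnot
    apply hv
    intro α hα i hi
    have hp : a (v, ⟨i, Nat.lt_succ_of_le hi⟩) ∈ E₀ := by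
      by_contra hne
      exact hnot ⟨(v, ⟨i, Nat.lt_succ_of_le hi⟩), hne, rfl⟩
    rw [ha hα ⟨i, Nat.lt_succ_of_le hi⟩] at hp
    exact hp
  -- the ℓ-adic number field `E := ι⁻¹(E₀)`
  refine ⟨E₀.comap (ι : PadicAlgCl ℓ →+* ℂ), finiteDimensional_comap ι E₀, ?_⟩
  filter_upwards [hplaces] with v hv α hα i
  have h0 : ∀ b ∈ α, b ≠ 0 := fun b hb => hasSatakeParamAt_ne_zero_holds hα b hb
  have hcard : Multiset.card α = n := hα.card_eq
  have hes : ∀ j ≤ Multiset.card α, α.esymm j ∈ E₀ := fun j hj => hv α hα j (hcard ▸ hj)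
  rw [arithFrobPolyOfSatake_one_eq_map, Polynomial.coeff_map, Subfield.mem_comap]
  simpa using coeff_prod_X_sub_C_inv_mem h0 hes i

/-- **The crux BY NAME, from the two registered stubs** — the skeleton theorem: the proved
composition `lArithmeticity_of_countableGerms_autConj` (no sorry) applied to `stub_S4L` and
`stub_autConjL`; the verbatim text it returns is definitionally the route decl. [folklore] -/
theorem LArithmeticity_of :
    Summit.Langlands.Langlands.Theses.HeckeFieldDeRham.LArithmeticity :=
  lArithmeticity_of_countableGerms_autConj stub_S4L stub_autConjL

end Summit.Langlands.Langlands.Cruxes.LArithmeticity.ConjugatesBaire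

end
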